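import Mathlib
import Literature.Computability.AlgebraicComplexity.ArithCircuitProofs
import Literature.Computability.AlgebraicComplexity.MatMulTotalComplexityProofs
import Literature.Computability.AlgebraicComplexity.FastFourierTransform
import Literature.LinearAlgebra.Matrix.CauchyDeterminant
import Literature.Computability.AlgebraicComplexity.DivisionSLP
import Literature.LinearAlgebra.Matrix.CauchyLike

/-!
# Stub `stub_cauchyAlgebra` of crux `HiddenToeplitzCorners.ToeplitzLikeDetCost` (stmt-MatrixMultiplication-7491),
# line `Sketch`

GKO95 Lemma 1.1 and the block-elimination identities (pure linear algebra).

Target tree file: `Summits/MatrixMultiplication/MatrixMultiplication/Theorems/HiddenToeplitzCornersToeplitzLikeDetCostCauchyAlgebra.lean`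
(helper for the crux, landed with `--supports stmt-MatrixMultiplication-7491`). The theorem `stub_cauchyAlgebra`
below must keep EXACTLY this name and signature (it is registered on the crux).
-/

set_option linter.dupNamespace false

namespace Summit.MatrixMultiplication.MatrixMultiplication.Theorems

open scoped BigOperators Matrix
open Literature.Computability.AlgebraicComplexity Literature.LinearAlgebra.Matrix
open Literature.Computability.AlgebraicComplexity.ArithCircuit (FanInTwoSeq freeInputs)

noncomputable section

section CauchyAlgebraHelpers
variable {K : Type} [Field K]

/-- Displacement of the inverse: if `Dx C - C Dy = G Hᵗ` and `P = C⁻¹`, then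
`Dy P - P Dx = -(P G) (Hᵗ P)` (GKO 1995, §1). [cite: GohbergKailathOlshevsky1995, §1] -/
theorem cauchyAlgebra_inv_displacement {m p : Type*} [Fintype m] [Fintype p] [DecidableEq m]
    (Dx Dy C P : Matrix m m K) (G : Matrix m p K) (Ht : Matrix p m K)
    (hC : Dx * C - C * Dy = G * Ht) (hP1 : C * P = 1) (hP2 : P * C = 1) :
    Dy * P - P * Dx = -(P * G) * (Ht * P) := by
  have hP2' : ∀ X : Matrix m m K, P * (C * X) = X := fun X => by
    rw [← Matrix.mul_assoc, hP2, Matrix.one_mul]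
  have h := congrArg (fun X => P * X * P) hC
  simp only [Matrix.mul_sub, Matrix.sub_mul, Matrix.mul_assoc, hP1, Matrix.mul_one, hP2'] at h
  rw [← neg_sub, h]
  simp only [Matrix.neg_mul, Matrix.mul_assoc]

/-- Generic Schur-complement displacement computation behind GKO 1995, Lemma 1.1: from the four
displacement equations of the blocks `E, F, F', D` and a two-sided inverse `P` of `E`, the Schur
complement `D - F' P F` has displacement `(G₂ - F' P G₁) (H₂ᵗ - H₁ᵗ P F)`.
[cite: GohbergKailathOlshevsky1995, Lemma 1.1] -/
theorem cauchyAlgebra_schur_displacement {m₁ m₂ p : Type*} [Fintype m₁] [Fintype m₂] [Fintype p]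
    [DecidableEq m₁]
    (Dx₁ Dy₁ E P : Matrix m₁ m₁ K) (Dx₂ Dy₂ D : Matrix m₂ m₂ K) (F : Matrix m₁ m₂ K)
    (F' : Matrix m₂ m₁ K) (G₁ : Matrix m₁ p K) (H₁t : Matrix p m₁ K) (G₂ : Matrix m₂ p K)
    (H₂t : Matrix p m₂ K)
    (hE : Dx₁ * E - E * Dy₁ = G₁ * H₁t) (hF : Dx₁ * F - F * Dy₂ = G₁ * H₂t)
    (hF' : Dx₂ * F' - F' * Dy₁ = G₂ * H₁t) (hD : Dx₂ * D - D * Dy₂ = G₂ * H₂t)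
    (hP1 : E * P = 1) (hP2 : P * E = 1) :
    Dx₂ * (D - F' * P * F) - (D - F' * P * F) * Dy₂ =
      (G₂ - F' * (P * G₁)) * (H₂t - H₁t * (P * F)) := by
  have h1 : Dx₂ * F' = G₂ * H₁t + F' * Dy₁ := by rw [← hF']; abel
  have h2 : F * Dy₂ = Dx₁ * F - G₁ * H₂t := by rw [← hF]; abel
  have hkey : Dy₁ * P - P * Dx₁ = -(P * G₁) * (H₁t * P) :=
    cauchyAlgebra_inv_displacement Dx₁ Dy₁ E P G₁ H₁t hE hP1 hP2
  calc Dx₂ * (D - F' * P * F) - (D - F' * P * F) * Dy₂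
      = (Dx₂ * D - D * Dy₂) - Dx₂ * F' * (P * F) + F' * P * (F * Dy₂) := by
        simp only [Matrix.mul_sub, Matrix.sub_mul, Matrix.mul_assoc]; abel
    _ = G₂ * H₂t - G₂ * (H₁t * (P * F)) - F' * ((Dy₁ * P - P * Dx₁) * F)
          - F' * (P * (G₁ * H₂t)) := by
        rw [hD, h1, h2]
        simp only [Matrix.mul_sub, Matrix.sub_mul, Matrix.add_mul, Matrix.mul_assoc]; abel
    _ = (G₂ - F' * (P * G₁)) * (H₂t - H₁t * (P * F)) := by
        rw [hkey]
        simp only [Matrix.mul_sub, Matrix.sub_mul, Matrix.mul_neg, Matrix.neg_mul,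
          Matrix.mul_assoc]
        abel

/-- **(A1)** GKO 1995, Lemma 1.1: the Schur complement of a Cauchy-like block matrix is Cauchy-like
with the one-step-eliminated generator. [cite: GohbergKailathOlshevsky1995, Lemma 1.1] -/
theorem cauchyAlgebra_schur (m₁ m₂ p : Type) [Fintype m₁] [Fintype m₂] [Fintype p]
    [DecidableEq m₁] [DecidableEq m₂]
    (x₁ y₁ : m₁ → K) (x₂ y₂ : m₂ → K) (G₁ H₁ : Matrix m₁ p K) (G₂ H₂ : Matrix m₂ p K)
    (h₁₁ : ∀ i j, x₁ i ≠ y₁ j) (h₁₂ : ∀ i j, x₁ i ≠ y₂ j) (h₂₁ : ∀ i j, x₂ i ≠ y₁ j)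
    (h₂₂ : ∀ i j, x₂ i ≠ y₂ j) (hE : IsUnit (cauchyLike x₁ y₁ G₁ H₁).det) :
    cauchyLike x₂ y₂ G₂ H₂ -
        cauchyLike x₂ y₁ G₂ H₁ * (cauchyLike x₁ y₁ G₁ H₁)⁻¹ * cauchyLike x₁ y₂ G₁ H₂ =
      cauchyLike x₂ y₂ (G₂ - cauchyLike x₂ y₁ G₂ H₁ * ((cauchyLike x₁ y₁ G₁ H₁)⁻¹ * G₁))
        (H₂ - ((cauchyLike x₁ y₁ G₁ H₁)⁻¹ * cauchyLike x₁ y₂ G₁ H₂)ᵀ * H₁) := by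
  refine eq_cauchyLike_of_displacement h₂₂ ?_
  simp only [Matrix.transpose_sub, Matrix.transpose_mul, Matrix.transpose_transpose]
  exact cauchyAlgebra_schur_displacement _ _ _ _ _ _ _ _ _ _ _ _ _
    (diagonal_mul_cauchyLike_sub x₁ y₁ G₁ H₁ h₁₁) (diagonal_mul_cauchyLike_sub x₁ y₂ G₁ H₂ h₁₂)
    (diagonal_mul_cauchyLike_sub x₂ y₁ G₂ H₁ h₂₁) (diagonal_mul_cauchyLike_sub x₂ y₂ G₂ H₂ h₂₂)
    (Matrix.mul_nonsing_inv _ hE) (Matrix.nonsing_inv_mul _ hE)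

/-- **(A2)** The inverse of a Cauchy-like matrix is Cauchy-like with swapped nodes and generator
`(-C⁻¹ G, (Hᵀ C⁻¹)ᵀ)` (GKO 1995, §1). [cite: GohbergKailathOlshevsky1995, §1] -/
theorem cauchyAlgebra_inv (m p : Type) [Fintype m] [Fintype p] [DecidableEq m] (x y : m → K)
    (G H : Matrix m p K) (hxy : ∀ i j, x i ≠ y j) (hC : IsUnit (cauchyLike x y G H).det) :
    (cauchyLike x y G H)⁻¹ =
      cauchyLike y x (-((cauchyLike x y G H)⁻¹ * G)) ((Hᵀ * (cauchyLike x y G H)⁻¹)ᵀ) := by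
  refine eq_cauchyLike_of_displacement (fun i j => (hxy j i).symm) ?_
  rw [Matrix.transpose_transpose]
  exact cauchyAlgebra_inv_displacement _ _ _ _ _ _ (diagonal_mul_cauchyLike_sub x y G H hxy)
    (Matrix.mul_nonsing_inv _ hC) (Matrix.nonsing_inv_mul _ hC)

/-- **(A5)** Determinant of a block matrix through the Schur complement of a unit top-left block.
[folklore] -/
theorem cauchyAlgebra_det_fromBlocks (m₁ m₂ : Type) [Fintype m₁] [Fintype m₂] [DecidableEq m₁]
    [DecidableEq m₂] (E : Matrix m₁ m₁ K) (F : Matrix m₁ m₂ K) (F' : Matrix m₂ m₁ K)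
    (D : Matrix m₂ m₂ K) (hE : IsUnit E.det) :
    (Matrix.fromBlocks E F F' D).det = E.det * (D - F' * E⁻¹ * F).det := by
  letI := Matrix.invertibleOfIsUnitDet E hE
  rw [Matrix.det_fromBlocks₁₁, Matrix.invOf_eq_nonsing_inv]

/-- **(A3)** Block elimination: the action of the inverse block matrix on a row-partitioned matrix,
and of a transposed row-partitioned matrix on it, through `E⁻¹` and the inverse Schur complement.
[folklore] -/
theorem cauchyAlgebra_blockInv (m₁ m₂ p : Type) [Fintype m₁] [Fintype m₂] [Fintype p]
    [DecidableEq m₁] [DecidableEq m₂]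
    (E : Matrix m₁ m₁ K) (F : Matrix m₁ m₂ K) (F' : Matrix m₂ m₁ K) (D : Matrix m₂ m₂ K)
    (G₁ H₁ : Matrix m₁ p K) (G₂ H₂ : Matrix m₂ p K)
    (hE : IsUnit E.det) (hS : IsUnit (D - F' * E⁻¹ * F).det) :
    (Matrix.fromBlocks E F F' D)⁻¹ * Matrix.fromRows G₁ G₂ =
        Matrix.fromRows
          (E⁻¹ * G₁ - E⁻¹ * (F * ((D - F' * E⁻¹ * F)⁻¹ * (G₂ - F' * (E⁻¹ * G₁)))))
          ((D - F' * E⁻¹ * F)⁻¹ * (G₂ - F' * (E⁻¹ * G₁))) ∧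
      (Matrix.fromRows H₁ H₂)ᵀ * (Matrix.fromBlocks E F F' D)⁻¹ =
        Matrix.fromCols
          (H₁ᵀ * E⁻¹ - (((H₂ᵀ - (H₁ᵀ * E⁻¹) * F) * (D - F' * E⁻¹ * F)⁻¹) * F') * E⁻¹)
          ((H₂ᵀ - (H₁ᵀ * E⁻¹) * F) * (D - F' * E⁻¹ * F)⁻¹) := by
  have hM : IsUnit (Matrix.fromBlocks E F F' D).det := by
    rw [cauchyAlgebra_det_fromBlocks m₁ m₂ E F F' D hE]; exact hE.mul hS
  have hST : (D - F' * E⁻¹ * F) * (D - F' * E⁻¹ * F)⁻¹ = 1 := Matrix.mul_nonsing_inv _ hS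
  have hTS : (D - F' * E⁻¹ * F)⁻¹ * (D - F' * E⁻¹ * F) = 1 := Matrix.nonsing_inv_mul _ hS
  set T := (D - F' * E⁻¹ * F)⁻¹ with hT
  constructor
  · have hMX : Matrix.fromBlocks E F F' D *
        Matrix.fromRows (E⁻¹ * G₁ - E⁻¹ * (F * (T * (G₂ - F' * (E⁻¹ * G₁)))))
          (T * (G₂ - F' * (E⁻¹ * G₁))) = Matrix.fromRows G₁ G₂ := by
      rw [Matrix.fromBlocks_mul_fromRows]
      congr 1
      · rw [Matrix.mul_sub, Matrix.mul_nonsing_inv_cancel_left _ _ hE,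
          Matrix.mul_nonsing_inv_cancel_left _ _ hE]
        abel
      · have : F' * (E⁻¹ * G₁ - E⁻¹ * (F * (T * (G₂ - F' * (E⁻¹ * G₁))))) +
              D * (T * (G₂ - F' * (E⁻¹ * G₁))) =
            F' * (E⁻¹ * G₁) + (D - F' * E⁻¹ * F) * T * (G₂ - F' * (E⁻¹ * G₁)) := by
          simp only [Matrix.mul_sub, Matrix.sub_mul, Matrix.mul_assoc]; abel
        rw [this, hST, Matrix.one_mul]
        abel
    rw [← hMX, Matrix.nonsing_inv_mul_cancel_left _ _ hM]
  · have hYM : Matrix.fromCols (H₁ᵀ * E⁻¹ - (((H₂ᵀ - (H₁ᵀ * E⁻¹) * F) * T) * F') * E⁻¹)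
          ((H₂ᵀ - (H₁ᵀ * E⁻¹) * F) * T) * Matrix.fromBlocks E F F' D =
        Matrix.fromCols H₁ᵀ H₂ᵀ := by
      rw [Matrix.fromCols_mul_fromBlocks]
      congr 1
      · rw [Matrix.sub_mul, Matrix.nonsing_inv_mul_cancel_right _ _ hE,
          Matrix.nonsing_inv_mul_cancel_right _ _ hE]
        abel
      · have : (H₁ᵀ * E⁻¹ - (((H₂ᵀ - (H₁ᵀ * E⁻¹) * F) * T) * F') * E⁻¹) * F +
              (H₂ᵀ - (H₁ᵀ * E⁻¹) * F) * T * D =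
            H₁ᵀ * (E⁻¹ * F) + (H₂ᵀ - (H₁ᵀ * E⁻¹) * F) * (T * (D - F' * E⁻¹ * F)) := by
          simp only [Matrix.mul_sub, Matrix.sub_mul, Matrix.mul_assoc]; abel
        rw [this, hTS, Matrix.mul_one, Matrix.mul_assoc]
        abel
    rw [Matrix.transpose_fromRows, ← hYM, Matrix.mul_nonsing_inv_cancel_right _ _ hM]

/-- **(A4)** The four sub-blocks of a Cauchy-like matrix along a splitting `m₁ ⊕ m₂ ≃ m` of the
index type are Cauchy-like with the restricted nodes and generator rows (GKO 1995, §1).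
[cite: GohbergKailathOlshevsky1995, §1] -/
theorem cauchyAlgebra_blocks (m m₁ m₂ p : Type) [Fintype m] [Fintype m₁] [Fintype m₂] [Fintype p]
    (e : m₁ ⊕ m₂ ≃ m) (x y : m → K) (G H : Matrix m p K) :
    (cauchyLike x y G H).submatrix e e =
      Matrix.fromBlocks
        (cauchyLike (x ∘ e ∘ Sum.inl) (y ∘ e ∘ Sum.inl) (G.submatrix (e ∘ Sum.inl) id)
          (H.submatrix (e ∘ Sum.inl) id))
        (cauchyLike (x ∘ e ∘ Sum.inl) (y ∘ e ∘ Sum.inr) (G.submatrix (e ∘ Sum.inl) id)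
          (H.submatrix (e ∘ Sum.inr) id))
        (cauchyLike (x ∘ e ∘ Sum.inr) (y ∘ e ∘ Sum.inl) (G.submatrix (e ∘ Sum.inr) id)
          (H.submatrix (e ∘ Sum.inl) id))
        (cauchyLike (x ∘ e ∘ Sum.inr) (y ∘ e ∘ Sum.inr) (G.submatrix (e ∘ Sum.inr) id)
          (H.submatrix (e ∘ Sum.inr) id)) := by
  ext (i | i) (j | j) <;> simp [cauchyLike_apply]

/-- **(A6)** Principal minors through the Schur complement: the minor on `m₁ ⊕ g(ι)` equals
`det M₁₁` times the corresponding minor of the Schur complement. [folklore] -/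
theorem cauchyAlgebra_minor (m₁ m₂ ι : Type) [Fintype m₁] [Fintype m₂] [Fintype ι]
    [DecidableEq m₁] [DecidableEq m₂] [DecidableEq ι] (M : Matrix (m₁ ⊕ m₂) (m₁ ⊕ m₂) K)
    (g : ι → m₂) (hM : IsUnit M.toBlocks₁₁.det) :
    (M.submatrix (Sum.map id g) (Sum.map id g)).det =
      M.toBlocks₁₁.det *
        ((M.toBlocks₂₂ - M.toBlocks₂₁ * M.toBlocks₁₁⁻¹ * M.toBlocks₁₂).submatrix g g).det := by
  have hsub : M.submatrix (Sum.map id g) (Sum.map id g) =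
      Matrix.fromBlocks M.toBlocks₁₁ (M.toBlocks₁₂.submatrix id g) (M.toBlocks₂₁.submatrix g id)
        (M.toBlocks₂₂.submatrix g g) := by
    ext (i | i) (j | j) <;> rfl
  have hschur : (M.toBlocks₂₂ - M.toBlocks₂₁ * M.toBlocks₁₁⁻¹ * M.toBlocks₁₂).submatrix g g =
      M.toBlocks₂₂.submatrix g g -
        M.toBlocks₂₁.submatrix g id * M.toBlocks₁₁⁻¹ * M.toBlocks₁₂.submatrix id g := by
    rw [Matrix.submatrix_sub, Pi.sub_apply, Pi.sub_apply,
      Matrix.submatrix_mul _ _ g id g Function.bijective_id,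
      Matrix.submatrix_mul _ _ g id id Function.bijective_id, Matrix.submatrix_id_id]
  rw [hsub, cauchyAlgebra_det_fromBlocks m₁ ι _ _ _ _ hM, hschur]

end CauchyAlgebraHelpers

section KLevel
variable {K : Type} [Field K] [Algebra ℂ K]

/-- **Stub `cauchyAlgebra`** — see `Lines/Sketch.lean`. [cite: GohbergKailathOlshevsky1995, Lemma 1.1] -/
theorem stub_cauchyAlgebra :
    (∀ (m₁ m₂ p : Type) [Fintype m₁] [Fintype m₂] [Fintype p] [DecidableEq m₁] [DecidableEq m₂]
        (x₁ y₁ : m₁ → K) (x₂ y₂ : m₂ → K) (G₁ H₁ : Matrix m₁ p K) (G₂ H₂ : Matrix m₂ p K),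
        (∀ i j, x₁ i ≠ y₁ j) → (∀ i j, x₁ i ≠ y₂ j) → (∀ i j, x₂ i ≠ y₁ j) → (∀ i j, x₂ i ≠ y₂ j) →
        IsUnit (cauchyLike x₁ y₁ G₁ H₁).det →
        cauchyLike x₂ y₂ G₂ H₂ - cauchyLike x₂ y₁ G₂ H₁ * (cauchyLike x₁ y₁ G₁ H₁)⁻¹ * cauchyLike x₁ y₂ G₁ H₂ =
          cauchyLike x₂ y₂ (G₂ - cauchyLike x₂ y₁ G₂ H₁ * ((cauchyLike x₁ y₁ G₁ H₁)⁻¹ * G₁))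
            (H₂ - ((cauchyLike x₁ y₁ G₁ H₁)⁻¹ * cauchyLike x₁ y₂ G₁ H₂)ᵀ * H₁)) ∧
    (∀ (m p : Type) [Fintype m] [Fintype p] [DecidableEq m] (x y : m → K) (G H : Matrix m p K),
        (∀ i j, x i ≠ y j) → IsUnit (cauchyLike x y G H).det →
        (cauchyLike x y G H)⁻¹ =
          cauchyLike y x (-((cauchyLike x y G H)⁻¹ * G)) ((Hᵀ * (cauchyLike x y G H)⁻¹)ᵀ)) ∧
    (∀ (m₁ m₂ p : Type) [Fintype m₁] [Fintype m₂] [Fintype p] [DecidableEq m₁] [DecidableEq m₂]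
        (E : Matrix m₁ m₁ K) (F : Matrix m₁ m₂ K) (F' : Matrix m₂ m₁ K) (D : Matrix m₂ m₂ K)
        (G₁ H₁ : Matrix m₁ p K) (G₂ H₂ : Matrix m₂ p K),
        IsUnit E.det → IsUnit (D - F' * E⁻¹ * F).det →
        (Matrix.fromBlocks E F F' D)⁻¹ * Matrix.fromRows G₁ G₂ =
            Matrix.fromRows
              (E⁻¹ * G₁ - E⁻¹ * (F * ((D - F' * E⁻¹ * F)⁻¹ * (G₂ - F' * (E⁻¹ * G₁)))))
              ((D - F' * E⁻¹ * F)⁻¹ * (G₂ - F' * (E⁻¹ * G₁))) ∧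
          (Matrix.fromRows H₁ H₂)ᵀ * (Matrix.fromBlocks E F F' D)⁻¹ =
            Matrix.fromCols
              (H₁ᵀ * E⁻¹ - (((H₂ᵀ - (H₁ᵀ * E⁻¹) * F) * (D - F' * E⁻¹ * F)⁻¹) * F') * E⁻¹)
              ((H₂ᵀ - (H₁ᵀ * E⁻¹) * F) * (D - F' * E⁻¹ * F)⁻¹)) ∧
    (∀ (m m₁ m₂ p : Type) [Fintype m] [Fintype m₁] [Fintype m₂] [Fintype p]
        (e : m₁ ⊕ m₂ ≃ m) (x y : m → K) (G H : Matrix m p K),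
        (cauchyLike x y G H).submatrix e e =
          Matrix.fromBlocks
            (cauchyLike (x ∘ e ∘ Sum.inl) (y ∘ e ∘ Sum.inl) (G.submatrix (e ∘ Sum.inl) id) (H.submatrix (e ∘ Sum.inl) id))
            (cauchyLike (x ∘ e ∘ Sum.inl) (y ∘ e ∘ Sum.inr) (G.submatrix (e ∘ Sum.inl) id) (H.submatrix (e ∘ Sum.inr) id))
            (cauchyLike (x ∘ e ∘ Sum.inr) (y ∘ e ∘ Sum.inl) (G.submatrix (e ∘ Sum.inr) id) (H.submatrix (e ∘ Sum.inl) id))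
            (cauchyLike (x ∘ e ∘ Sum.inr) (y ∘ e ∘ Sum.inr) (G.submatrix (e ∘ Sum.inr) id) (H.submatrix (e ∘ Sum.inr) id))) ∧
    (∀ (m₁ m₂ : Type) [Fintype m₁] [Fintype m₂] [DecidableEq m₁] [DecidableEq m₂]
        (E : Matrix m₁ m₁ K) (F : Matrix m₁ m₂ K) (F' : Matrix m₂ m₁ K) (D : Matrix m₂ m₂ K),
        IsUnit E.det → (Matrix.fromBlocks E F F' D).det = E.det * (D - F' * E⁻¹ * F).det) ∧
    (∀ (m₁ m₂ ι : Type) [Fintype m₁] [Fintype m₂] [Fintype ι] [DecidableEq m₁] [DecidableEq m₂]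
        [DecidableEq ι] (M : Matrix (m₁ ⊕ m₂) (m₁ ⊕ m₂) K) (g : ι → m₂), IsUnit M.toBlocks₁₁.det →
        (M.submatrix (Sum.map id g) (Sum.map id g)).det =
          M.toBlocks₁₁.det *
            ((M.toBlocks₂₂ - M.toBlocks₂₁ * M.toBlocks₁₁⁻¹ * M.toBlocks₁₂).submatrix g g).det) := by
  -- `[Algebra ℂ K]` belongs to the registered signature but is not needed: reference it once.
  have _hK : Algebra ℂ K := inferInstance
  exact ⟨cauchyAlgebra_schur, cauchyAlgebra_inv, cauchyAlgebra_blockInv, cauchyAlgebra_blocks,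
    cauchyAlgebra_det_fromBlocks, cauchyAlgebra_minor⟩

end KLevel

end

end Summit.MatrixMultiplication.MatrixMultiplication.Theorems
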